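import Summits.AtomisticToContinuum.BoseEinsteinCondensation.Theorems.BECHardSphereReductionHardSphereBECPositivityTransferHS
import Summits.AtomisticToContinuum.BoseEinsteinCondensation.Theorems.BECCutLineWeakDisorderGroundStateRigidityHardCoreOfConnected
import Summits.AtomisticToContinuum.BoseEinsteinCondensation.Theorems.BECCutLineWeakDisorderGroundStateRigidityStubPosOfConnected

/-!
# Crux `HardSphereBEC` (stmt-11885), line `registered`, skeleton v4 — the sources of the formal kernel
# `stub_positivityTransferHS` (S1r): rigidity AT `HS₁` only, and the pure-geometry kernel `CubeConnected`

Route `BECHardSphereReduction`, lead c7 (2026-08-17; glue written by the wave-2 stub-worker on S1r, which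
returned `stub-blocked: stmt-AtomisticToContinuum-9072`).  Sequel of
`Theorems/BECHardSphereReductionHardSphereBECPositivityTransferHS.lean` (p160296: S1r ⟸ the whole shared
crux `GroundStateRigidity`, stmt-9072).  The registered stub S1r is the fixed-`N` positivity transfer for
unit hard spheres; this file records the two sharper conditionals available from LANDED facts:

* `positivityTransferHS_of_rigidHS` — S1r needs rigidity only AT `v := HS₁` (eventual phase rigidity of
  the unit-hard-sphere near-ground states along `L_N(ρ)`, `ρ` small), by the same frame as p160296
  (`groundStateEnergyFinite_proof`, `positiveNearMinimiserExists_proof`, `occupationStability_proof`);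
* `rigidHS_of_cubeConnected` — that rigidity follows from the pure-geometry kernel `CubeConnected`
  (Stub 21 `stub_cubeConnected` of crux 9072's line `Cruxes/GroundStateRigidity/Lines/Sketch.lean`, OPEN:
  path-connectedness of the dilute hard-sphere configuration space of a cube, `N b³ ≤ c₀ L³`;
  Baryshnikov–Bubenik–Kahle 2014 §6) through the landed `groundStateRigidity_hardCore_of_cubeConnected`
  (p130213) fed with the landed `stub_posOfConnected` (p126419): `HS₁ = ⊤·1_{(-∞,1]}` is in the essential
  hard-core class (`b = 1`, tail bound `C = 0`);
* `positivityTransferHS_of_cubeConnected` — the composite: **S1r ⟸ `CubeConnected`**.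

Closure map of the line after this file: crux ⟸ S1w ∧ S1r ∧ S2'; S1r ⟸ rigidity at HS₁ ⟸ 9072 | CubeConnected
(or any alternative kernel of 9072's line evaluated at `HS₁`).
-/

noncomputable section

namespace Summit.AtomisticToContinuum.BoseEinsteinCondensation.Cruxes.HardSphereBEC

open MeasureTheory ENNReal Filter Topology Literature.MathematicalPhysics.QuantumManyBody.BoseGas
open Summit.AtomisticToContinuum.BoseEinsteinCondensation.Theorems

/-- **Positivity transfer for unit hard spheres from rigidity AT `HS₁` ONLY** (same proof as
`positivityTransferHS_of_groundStateRigidity`, with the hypothesis weakened from the whole shared crux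
to its instance `v := HS₁`). [cite: LSSY2005, §1.2 (1.17)–(1.19)] -/
theorem positivityTransferHS_of_rigidHS
    (hrigHS : ∃ ρ₀ : ℝ, 0 < ρ₀ ∧ ∀ ρ : ℝ, 0 < ρ → ρ < ρ₀ → ∀ᶠ N : ℕ in atTop, ∀ η : ℝ, 0 < η →
      ∃ δ : ℝ≥0∞, 0 < δ ∧ ∀ Ψ Φ : TrialState N (sideLength ρ N),
        energy (Set.indicator (Set.Iic 1) (fun _ : ℝ => (⊤ : ℝ≥0∞))) Ψ ≤
          groundStateEnergy (Set.indicator (Set.Iic 1) (fun _ : ℝ => (⊤ : ℝ≥0∞))) N (sideLength ρ N) + δ →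
        energy (Set.indicator (Set.Iic 1) (fun _ : ℝ => (⊤ : ℝ≥0∞))) Φ ≤
          groundStateEnergy (Set.indicator (Set.Iic 1) (fun _ : ℝ => (⊤ : ℝ≥0∞))) N (sideLength ρ N) + δ →
        ∃ c : ℂ, ‖c‖ = 1 ∧ ∫⁻ X, (‖Ψ.ψ X - c * Φ.ψ X‖₊ : ℝ≥0∞) ^ 2 ≤ ENNReal.ofReal η) :
    ∃ η₁ : ℝ, 0 < η₁ ∧ ∀ η : ℝ, 0 < η → η < η₁ → ∀ᶠ N : ℕ in Filter.atTop, ∀ c : ℝ, 0 < c →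
      ∀ δ₁ : ENNReal, 0 < δ₁ →
        (∀ Φ : Literature.MathematicalPhysics.QuantumManyBody.BoseGas.TrialState N (Literature.MathematicalPhysics.QuantumManyBody.BoseGas.sideLength η N), Literature.MathematicalPhysics.QuantumManyBody.BoseGas.energy (Set.indicator (Set.Iic 1) (fun _ : ℝ => (⊤ : ENNReal))) Φ ≤ Literature.MathematicalPhysics.QuantumManyBody.BoseGas.groundStateEnergy (Set.indicator (Set.Iic 1) (fun _ : ℝ => (⊤ : ENNReal))) N (Literature.MathematicalPhysics.QuantumManyBody.BoseGas.sideLength η N) + δ₁ → (∀ X, Φ.ψ X = (‖Φ.ψ X‖ : ℂ)) → ENNReal.ofReal (c * N) ≤ Literature.MathematicalPhysics.QuantumManyBody.BoseGas.occupation N ((Literature.MathematicalPhysics.QuantumManyBody.BoseGas.box (Literature.MathematicalPhysics.QuantumManyBody.BoseGas.sideLength η N)).indicator fun _ => ((Real.sqrt (Literature.MathematicalPhysics.QuantumManyBody.BoseGas.sideLength η N ^ 3))⁻¹ : ℂ)) Φ.ψ) →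
        ∃ δ₂ : ENNReal, 0 < δ₂ ∧ ∀ Ψ : Literature.MathematicalPhysics.QuantumManyBody.BoseGas.TrialState N (Literature.MathematicalPhysics.QuantumManyBody.BoseGas.sideLength η N), Literature.MathematicalPhysics.QuantumManyBody.BoseGas.energy (Set.indicator (Set.Iic 1) (fun _ : ℝ => (⊤ : ENNReal))) Ψ ≤ Literature.MathematicalPhysics.QuantumManyBody.BoseGas.groundStateEnergy (Set.indicator (Set.Iic 1) (fun _ : ℝ => (⊤ : ENNReal))) N (Literature.MathematicalPhysics.QuantumManyBody.BoseGas.sideLength η N) + δ₂ → ENNReal.ofReal (c / 4 * N) ≤ Literature.MathematicalPhysics.QuantumManyBody.BoseGas.occupation N ((Literature.MathematicalPhysics.QuantumManyBody.BoseGas.box (Literature.MathematicalPhysics.QuantumManyBody.BoseGas.sideLength η N)).indicator fun _ => ((Real.sqrt (Literature.MathematicalPhysics.QuantumManyBody.BoseGas.sideLength η N ^ 3))⁻¹ : ℂ)) Ψ.ψ := by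
  obtain ⟨ρ₁, hρ₁, H1⟩ := groundStateEnergyFinite_proof _ isRepulsiveFiniteRange_unitHardSphere
  obtain ⟨ρ₂, hρ₂, H2⟩ := hrigHS
  refine ⟨min ρ₁ ρ₂, lt_min hρ₁ hρ₂, fun η hη hηlt => ?_⟩
  have hη1 : η < ρ₁ := hηlt.trans_le (min_le_left _ _)
  have hη2 : η < ρ₂ := hηlt.trans_le (min_le_right _ _)
  filter_upwards [H1 η hη hη1, H2 η hη hη2, eventually_ge_atTop 1] with N hE hR hN1
  intro c hc δ₁ hδ₁ hP
  obtain ⟨n, rfl⟩ : ∃ n, N = n + 1 := ⟨N - 1, by omega⟩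
  have hL : 0 < sideLength η (n + 1) := by
    unfold sideLength
    exact Real.rpow_pos_of_pos (div_pos (Nat.cast_pos.mpr n.succ_pos) hη) _
  obtain ⟨δr, hδr, HR⟩ := hR (c / 4) (by positivity)
  refine ⟨min δr δ₁, lt_min hδr hδ₁, fun Ψ hΨ => ?_⟩
  obtain ⟨Φ, hΦE, hΦpos⟩ := positiveNearMinimiserExists_proof _ (n + 1) _ hE (min δr δ₁) (lt_min hδr hδ₁)
  obtain ⟨c₁, hc₁, hclose⟩ := HR Φ Ψ (hΦE.trans (add_le_add_right (min_le_left _ _) _))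
    (hΨ.trans (add_le_add_right (min_le_left _ _) _))
  have hoccΦ := hP Φ (hΦE.trans (add_le_add_right (min_le_right _ _) _)) hΦpos
  have hst := occupationStability_proof n _ _
    (_root_.AtomisticToContinuum.BECInfraredBound.aestronglyMeasurable_constMode _)
    (_root_.AtomisticToContinuum.BECInfraredBound.lintegral_constMode_sq hL) Φ Ψ c₁ hc₁
  have h4 : ENNReal.ofReal (c * ((n + 1 : ℕ) : ℝ)) =
      4 * (ENNReal.ofReal (c / 4) * ((n + 1 : ℕ) : ℝ≥0∞)) := by
    have : c * ((n + 1 : ℕ) : ℝ) = 4 * (c / 4 * ((n + 1 : ℕ) : ℝ)) := by ring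
    rw [this, ENNReal.ofReal_mul (by norm_num : (0 : ℝ) ≤ 4),
      ENNReal.ofReal_mul (by positivity : (0 : ℝ) ≤ c / 4), ENNReal.ofReal_ofNat,
      ENNReal.ofReal_natCast]
  rw [h4] at hoccΦ
  have key := PositivityTransfer.mul_le_of_sqrt_le (ENNReal.natCast_ne_top _) ENNReal.ofReal_ne_top
    hoccΦ hst hclose
  rwa [← ENNReal.ofReal_natCast, ← ENNReal.ofReal_mul (by positivity : (0 : ℝ) ≤ c / 4)] at key

/-- **Rigidity of the unit-hard-sphere near-ground states from `CubeConnected`**: `HS₁ = ⊤·1_{(-∞,1]}`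
is in the essential hard-core class (`b = 1`, tail bound `C = 0`), so the landed conditional
`groundStateRigidity_hardCore_of_cubeConnected` (with `stub_posOfConnected`) applies.
[cite: ReedSimonIV1978, §XIII.12 Thm XIII.47] -/
theorem rigidHS_of_cubeConnected
    (hCC : ∃ c₀ : ℝ, 0 < c₀ ∧ ∀ (N : ℕ) (L b : ℝ), 0 < b → (N : ℝ) * b ^ 3 ≤ c₀ * L ^ 3 →
      ∀ X ∈ {Z : Config N | Z ∈ boxN N L ∧ ∀ i j : Fin N, i ≠ j → b < dist (Z i) (Z j)},
      ∀ Y ∈ {Z : Config N | Z ∈ boxN N L ∧ ∀ i j : Fin N, i ≠ j → b < dist (Z i) (Z j)},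
        JoinedIn {Z : Config N | Z ∈ boxN N L ∧ ∀ i j : Fin N, i ≠ j → b < dist (Z i) (Z j)} X Y) :
    ∃ ρ₀ : ℝ, 0 < ρ₀ ∧ ∀ ρ : ℝ, 0 < ρ → ρ < ρ₀ → ∀ᶠ N : ℕ in atTop, ∀ η : ℝ, 0 < η →
      ∃ δ : ℝ≥0∞, 0 < δ ∧ ∀ Ψ Φ : TrialState N (sideLength ρ N),
        energy (Set.indicator (Set.Iic 1) (fun _ : ℝ => (⊤ : ℝ≥0∞))) Ψ ≤
          groundStateEnergy (Set.indicator (Set.Iic 1) (fun _ : ℝ => (⊤ : ℝ≥0∞))) N (sideLength ρ N) + δ →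
        energy (Set.indicator (Set.Iic 1) (fun _ : ℝ => (⊤ : ℝ≥0∞))) Φ ≤
          groundStateEnergy (Set.indicator (Set.Iic 1) (fun _ : ℝ => (⊤ : ℝ≥0∞))) N (sideLength ρ N) + δ →
        ∃ c : ℂ, ‖c‖ = 1 ∧ ∫⁻ X, (‖Ψ.ψ X - c * Φ.ψ X‖₊ : ℝ≥0∞) ^ 2 ≤ ENNReal.ofReal η := by
  refine GroundStateRigidity.groundStateRigidity_hardCore_of_cubeConnected
    GroundStateRigidity.stub_posOfConnected hCC _ isRepulsiveFiniteRange_unitHardSphere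
    ⟨1, one_pos, 0, Filter.Eventually.of_forall (fun s hs => ?_),
      Filter.Eventually.of_forall (fun s hs => ?_)⟩
  · exact Set.indicator_of_mem (show s ∈ Set.Iic (1 : ℝ) from hs.2) _
  · rw [Set.indicator_of_notMem (show s ∉ Set.Iic (1 : ℝ) from fun h => (not_le.mpr hs) h)]
    exact zero_le

/-- **S1r ⟸ `CubeConnected`** (Stub 21 of crux 9072's line `Sketch`, OPEN pure geometry): the
registered stub `stub_positivityTransferHS` of skeleton v4, verbatim, from dilute hard-sphere
connectivity alone. [cite: LSSY2005, §1.2 (1.17)–(1.19)] -/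
theorem positivityTransferHS_of_cubeConnected
    (hCC : ∃ c₀ : ℝ, 0 < c₀ ∧ ∀ (N : ℕ) (L b : ℝ), 0 < b → (N : ℝ) * b ^ 3 ≤ c₀ * L ^ 3 →
      ∀ X ∈ {Z : Config N | Z ∈ boxN N L ∧ ∀ i j : Fin N, i ≠ j → b < dist (Z i) (Z j)},
      ∀ Y ∈ {Z : Config N | Z ∈ boxN N L ∧ ∀ i j : Fin N, i ≠ j → b < dist (Z i) (Z j)},
        JoinedIn {Z : Config N | Z ∈ boxN N L ∧ ∀ i j : Fin N, i ≠ j → b < dist (Z i) (Z j)} X Y) :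
    ∃ η₁ : ℝ, 0 < η₁ ∧ ∀ η : ℝ, 0 < η → η < η₁ → ∀ᶠ N : ℕ in Filter.atTop, ∀ c : ℝ, 0 < c →
      ∀ δ₁ : ENNReal, 0 < δ₁ →
        (∀ Φ : Literature.MathematicalPhysics.QuantumManyBody.BoseGas.TrialState N (Literature.MathematicalPhysics.QuantumManyBody.BoseGas.sideLength η N), Literature.MathematicalPhysics.QuantumManyBody.BoseGas.energy (Set.indicator (Set.Iic 1) (fun _ : ℝ => (⊤ : ENNReal))) Φ ≤ Literature.MathematicalPhysics.QuantumManyBody.BoseGas.groundStateEnergy (Set.indicator (Set.Iic 1) (fun _ : ℝ => (⊤ : ENNReal))) N (Literature.MathematicalPhysics.QuantumManyBody.BoseGas.sideLength η N) + δ₁ → (∀ X, Φ.ψ X = (‖Φ.ψ X‖ : ℂ)) → ENNReal.ofReal (c * N) ≤ Literature.MathematicalPhysics.QuantumManyBody.BoseGas.occupation N ((Literature.MathematicalPhysics.QuantumManyBody.BoseGas.box (Literature.MathematicalPhysics.QuantumManyBody.BoseGas.sideLength η N)).indicator fun _ => ((Real.sqrt (Literature.MathematicalPhysics.QuantumManyBody.BoseGas.sideLength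 η N ^ 3))⁻¹ : ℂ)) Φ.ψ) →
        ∃ δ₂ : ENNReal, 0 < δ₂ ∧ ∀ Ψ : Literature.MathematicalPhysics.QuantumManyBody.BoseGas.TrialState N (Literature.MathematicalPhysics.QuantumManyBody.BoseGas.sideLength η N), Literature.MathematicalPhysics.QuantumManyBody.BoseGas.energy (Set.indicator (Set.Iic 1) (fun _ : ℝ => (⊤ : ENNReal))) Ψ ≤ Literature.MathematicalPhysics.QuantumManyBody.BoseGas.groundStateEnergy (Set.indicator (Set.Iic 1) (fun _ : ℝ => (⊤ : ENNReal))) N (Literature.MathematicalPhysics.QuantumManyBody.BoseGas.sideLength η N) + δ₂ → ENNReal.ofReal (c / 4 * N) ≤ Literature.MathematicalPhysics.QuantumManyBody.BoseGas.occupation N ((Literature.MathematicalPhysics.QuantumManyBody.BoseGas.box (Literature.MathematicalPhysics.QuantumManyBody.BoseGas.sideLength η N)).indicator fun _ => ((Real.sqrt (Literature.MathematicalPhysics.QuantumManyBody.BoseGas.sideLength η N ^ 3))⁻¹ : ℂ)) Ψ.ψ :=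
  positivityTransferHS_of_rigidHS (rigidHS_of_cubeConnected hCC)

end Summit.AtomisticToContinuum.BoseEinsteinCondensation.Cruxes.HardSphereBEC

end
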